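import Literature.NumberTheory.LFunctions.HalaszRestrictedMultWindow
import Literature.NumberTheory.LFunctions.HalaszRestrictedShortEuler
import Literature.NumberTheory.LFunctions.HalaszRestrictedSharpTwists
import HarnessLib

/-!
# Restricted Halász without the polynomial factor, II: the sharp per-`α` profile

Topic `Literature/NumberTheory/LFunctions`.  Everything in this file is PROVED; no definitions, no named facts.
Second part of the series (after `HalaszRestrictedSharpTwists.lean`; the window theorem is part III,
`HalaszRestrictedSharp.lean`).

Halász's theorem for block-restricted sums (`a = g̃ 1_𝒮`, `g` completely multiplicative with `|g| ≤ 1`,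
`𝒮` = integers with a prime factor in every block of a system of small primes) is proved in the tree with the main
term `(1 + M_½) e^{-M_½}`, `M_½ ≥ M/2` the minimum of the HALVED distance (`Halasz.Restricted.norm_restr_sum_le`,
`Halasz.Restricted.norm_restr_interval_sum_le`), which in the window `|t - t₁| ≤ (log X)^{1/16}` of
Matomäki–Radziwiłł–Tao 2015, Proposition A.3 gives the middle terms `(1 + M) e^{-M/2}` or `(1 + M)² e^{-M}`, not the
printed `(1 + M) e^{-M}`.  The factor `(1 + M_½)` comes from the two-regime `α`-integration of Granville–Soundararajan
(§4) fed with the UNIFORM bound `B_w = e⁷ log x · e^{-M_½}` on `Re s = 1`.  The sharp profile of this file instead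
distinguishes, at each `(α, y)`, whether the damped off-block distance
`D_O(α,y) = ∑_{p ≤ x, p ∉ E} p^{-α}(1 - Re g(p)p^{-iy})/p` is `≥ M/2` (then the factorised Euler product gives
`e^{12} e^{-M/2}/α` outright) or `< M/2` ("dangerous").  Dangerous points cluster within `e^{O(M)}/log x` of one of
them (part I, `Sharp.twist_cluster_of_vk`), so they all see one frozen block configuration `d`
(`Sharp.abs_sum_dampedDist_sub_le`); every twist `|u| ≤ T` then has off-block distance `≥ M - d - 1`, and Poisson
smoothing of the OFF-BLOCK Euler product alone gives `e^{8.5} log x · e^{-(M-d)} e^{-d/2}`, the direct bound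
`e^{12.5} e^{-d/2}/α`: the profile `e^{-d/2} min(log x · e^{-(M-d)}, 1/α)`, whose `dα/α`-integral is
`≤ 2 log x · e^{-M/2}` with no factor `M` (part III).

* `Halasz.setIntegral_le_of_three_regimes` — `∫_{α₀}^1 I ≤ P log(α₁/α₀) + c + E/α₀ + Q'/α₁ + Q/α₂` from bounds
  `P/α + c + E/α²`, `Q'/α² + c`, `Q/α²` on `[α₀,α₁]`, `[α₁,α₂]`, `[α₂,1]` (for part III);
* `Halasz.Restricted.Sharp.dampedTerm_eq`, `…dampedTerm_zero_eq`, `…dampedTerm_nonneg`,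
  `…distTerm_le_three_mul_dampedTerm` — the damped summand `p^{-(1+α)} - Re(g(p)p^{-(1+α+iy)}) = p^{-α}(1 - Re g(p) conj p^{iy})/p`;
* `…norm_LSeries_restr_le_exp_damped` — `‖𝒢_a(1+α+iy)‖ ≤ (e^{12}/α) exp(-D_O(α,y) - D_E(α,y)/2)` (`LSeries_restr_eq`,
  the cosh trick `norm_prod_blockEuler_sub_one_le`, `∑_{p ≤ N} p^{-1-α} ≤ log(1/α) + 9`);
* `…twistDist_tail_le_three_mul_outSum`, `…pretentiousDistSq_eq_outSum_add_blkSum`, `…blkSum_eq_damped`,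
  `…dampedSum_nonneg`, `…blocks_exponent_eq`, `…norm_prod_blockEuler_sub_one_le_damped`, `…norm_blockEuler_out_line_le`,
  `…norm_blockEuler_out_shift_le` — tail domination, the split of `𝔻²` at `α = 0`, the block factors
  `≤ exp(K₀ + 2 - D_E/2)`, the off-block product on the line and its Poisson transport
  (`PoissonSmoothing.norm_LSeries_le_of_bound` applied to `g 1_{(n,E)=1}` cut to friable integers, `LSeries_sieveOut_eq`);
* `…norm_LSeries_restr_sharp` — **the sharp per-`α` bound**: block primes `≤ Q ≤ exp((log 2x)^θ) - 1`, `4 ≤ T ≤ x`,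
  a scale `α_m` with `exp((log 2x)^θ) ≤ e^{1/α_m} ≤ x`, the clustering inequality at `X = 2x` (constant `C`),
  `∑_{p ∈ E} log p/p ≤ L`, and the regime conditions `9M + 60 + C ≤ log(1/α_m) - θ log log 2x`,
  `(2 + e^{9M+60+C}) α_m L ≤ 1`; then there is `d ≥ 0` with
  `‖𝒢_a(1+α+iy)‖ ≤ e^{12} e^{-M/2}/α + e^{13} e^{-d/2} min(log x · e^{-(M-d)}, 1/α) + e^{K₀+8}(4α/T) log x`
  for `0 < α ≤ α_m`, `|y| ≤ T/2` (`M = Sieve.minPretentiousDistSq g x T`, `K₀ = ∑_{p ∈ E} 1/p`);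
* `…add_one_mul_exp_neg_half_le_two`, `…log_add_two_le_two_sqrt`, `…exp_add_one_le_exp_add_one` — small real
  inequalities for part III.

## References
* A. Granville, K. Soundararajan, *Decay of mean values of multiplicative functions*, Canad. J. Math. 55 (2003),
  Lemma 2.2 (Poisson smoothing), §4 (the `α`-integration). [cite: GranvilleSoundararajan2003, Theorem 1]
* K. Matomäki, M. Radziwiłł, T. Tao, *An averaged form of Chowla's conjecture*, Algebra & Number Theory 9 (2015),
  Appendix A, Proposition A.3 and its proof (the ranges `𝒯₀ ∪ 𝒯₁`). [cite: MatomakiRadziwillTao2015, Appendix A, Proposition A.3]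
* K. Matomäki, M. Radziwiłł, *Multiplicative functions in short intervals II*, arXiv:2007.04290, Lemma 5.3 and the
  Remark after Theorem 9.2. [cite: MatomakiRadziwill2020ShortIntervalsII, Lemma 5.3]

## Design choices
* The damped distances are written as explicit sums (no definitions); the clustering inequality, the scale `α_m` and the
  two regime conditions are hypotheses here and are discharged from `34 M + C_r ≤ log log x` in part III.
* Constants crude and explicit (`e^{12}`, `e^{13}`, `e^{K₀+8}`, the factor `3 ≥ e` in tail domination).
-/

noncomputable section

open Finset Real Complex MeasureTheory Filter
open scoped ComplexConjugate

namespace Literature.NumberTheory.LFunctions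

namespace Halasz

open MellinPlancherel (psum)

/-! ### The three-regime `α`-integration -/

/-- **Three-regime `α`-integration**: if `I(α) ≤ P/α + c + E/α²` on `[α₀, α₁]`, `I(α) ≤ Q'/α² + c` on
`[α₁, α₂]` and `I(α) ≤ Q/α²` on `[α₂, 1]` (`0 < α₀ ≤ α₁ ≤ α₂ ≤ 1`, nonnegative constants), then
`∫_{α₀}^1 I ≤ P log(α₁/α₀) + c + E/α₀ + Q'/α₁ + Q/α₂`.  (The profile of the sharp restricted Halász theorem has
a logarithmic piece only up to `α₁ = e^{M-d}/log x`.) [cite: GranvilleSoundararajan2003, (4.3)] -/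
theorem setIntegral_le_of_three_regimes {I : ℝ → ℝ} {α₀ α₁ α₂ : ℝ} (h0 : 0 < α₀) (h01 : α₀ ≤ α₁)
    (h12 : α₁ ≤ α₂) (h2 : α₂ ≤ 1) (hI : IntegrableOn I (Set.Ioc α₀ 1)) {P c E Q' Q : ℝ}
    (hc : 0 ≤ c) (hE : 0 ≤ E) (hQ' : 0 ≤ Q') (hQ : 0 ≤ Q)
    (hb1 : ∀ α ∈ Set.Icc α₀ α₁, I α ≤ P / α + c + E / α ^ 2)
    (hb2 : ∀ α ∈ Set.Icc α₁ α₂, I α ≤ Q' / α ^ 2 + c)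
    (hb3 : ∀ α ∈ Set.Icc α₂ 1, I α ≤ Q / α ^ 2) :
    ∫ α in Set.Ioc α₀ 1, I α ≤ P * Real.log (α₁ / α₀) + c + E / α₀ + Q' / α₁ + Q / α₂ := by
  have hα1 : 0 < α₁ := h0.trans_le h01
  have hα2 : 0 < α₂ := hα1.trans_le h12
  have h02 : α₀ ≤ α₂ := h01.trans h12
  have h1le : α₁ ≤ 1 := h12.trans h2
  have hI01 : IntervalIntegrable I volume α₀ 1 := by
    rw [intervalIntegrable_iff_integrableOn_Ioc_of_le (h02.trans h2)]; exact hI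
  have hIa : IntervalIntegrable I volume α₀ α₁ :=
    hI01.mono_set (by rw [Set.uIcc_of_le h01, Set.uIcc_of_le (h02.trans h2)];
                      exact Set.Icc_subset_Icc le_rfl h1le)
  have hIb : IntervalIntegrable I volume α₁ α₂ :=
    hI01.mono_set (by rw [Set.uIcc_of_le h12, Set.uIcc_of_le (h02.trans h2)];
                      exact Set.Icc_subset_Icc h01 h2)
  have hIc : IntervalIntegrable I volume α₂ 1 :=
    hI01.mono_set (by rw [Set.uIcc_of_le h2, Set.uIcc_of_le (h02.trans h2)];
                      exact Set.Icc_subset_Icc h02 le_rfl)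
  -- continuity of the majorants
  have hci : ∀ {a b : ℝ}, 0 < a → a ≤ b → ContinuousOn (fun α : ℝ => 1 / α) (Set.uIcc a b) := by
    intro a b ha hab
    rw [Set.uIcc_of_le hab]
    exact continuousOn_const.div continuousOn_id fun α hα => ne_of_gt (ha.trans_le hα.1)
  have hci2 : ∀ {a b : ℝ}, 0 < a → a ≤ b → ContinuousOn (fun α : ℝ => 1 / α ^ 2) (Set.uIcc a b) := by
    intro a b ha hab
    rw [Set.uIcc_of_le hab]
    exact continuousOn_const.div (continuousOn_id.pow 2) fun α hα => pow_ne_zero 2 (ne_of_gt (ha.trans_le hα.1))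
  -- first range
  have hfirst : ∫ α in α₀..α₁, I α ≤ P * Real.log (α₁ / α₀) + c * (α₁ - α₀) + E / α₀ - E / α₁ := by
    have hmaj : ContinuousOn (fun α : ℝ => P * (1 / α) + c + E * (1 / α ^ 2)) (Set.uIcc α₀ α₁) :=
      (((hci h0 h01).const_smul P).add continuousOn_const).add ((hci2 h0 h01).const_smul E)
    calc ∫ α in α₀..α₁, I α ≤ ∫ α in α₀..α₁, (P * (1 / α) + c + E * (1 / α ^ 2)) :=
          intervalIntegral.integral_mono_on h01 hIa hmaj.intervalIntegrable fun α hα => by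
            have := hb1 α hα; simp only [mul_one_div]; linarith
      _ = P * Real.log (α₁ / α₀) + c * (α₁ - α₀) + E * (1 / α₀ - 1 / α₁) := by
          have hi1 : IntervalIntegrable (fun α : ℝ => P * (1 / α)) volume α₀ α₁ :=
            ((hci h0 h01).intervalIntegrable).const_mul P
          have hi2 : IntervalIntegrable (fun _ : ℝ => c) volume α₀ α₁ := intervalIntegrable_const
          have hi3 : IntervalIntegrable (fun α : ℝ => E * (1 / α ^ 2)) volume α₀ α₁ :=
            ((hci2 h0 h01).intervalIntegrable).const_mul E
          rw [intervalIntegral.integral_add (hi1.add hi2) hi3, intervalIntegral.integral_add hi1 hi2,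
            intervalIntegral.integral_const, smul_eq_mul, intervalIntegral.integral_const_mul,
            intervalIntegral.integral_const_mul, integral_one_div_of_pos h0 hα1, integral_one_div_sq h0 h01]
          ring
      _ = P * Real.log (α₁ / α₀) + c * (α₁ - α₀) + E / α₀ - E / α₁ := by ring
  -- middle range
  have hsecond : ∫ α in α₁..α₂, I α ≤ Q' / α₁ - Q' / α₂ + c * (α₂ - α₁) := by
    have hmaj : ContinuousOn (fun α : ℝ => Q' * (1 / α ^ 2) + c) (Set.uIcc α₁ α₂) :=
      ((hci2 hα1 h12).const_smul Q').add continuousOn_const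
    calc ∫ α in α₁..α₂, I α ≤ ∫ α in α₁..α₂, (Q' * (1 / α ^ 2) + c) :=
          intervalIntegral.integral_mono_on h12 hIb hmaj.intervalIntegrable fun α hα => by
            have := hb2 α hα; simp only [mul_one_div]; linarith
      _ = Q' * (1 / α₁ - 1 / α₂) + c * (α₂ - α₁) := by
          have hi1 : IntervalIntegrable (fun α : ℝ => Q' * (1 / α ^ 2)) volume α₁ α₂ :=
            ((hci2 hα1 h12).intervalIntegrable).const_mul Q'
          have hi2 : IntervalIntegrable (fun _ : ℝ => c) volume α₁ α₂ := intervalIntegrable_const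
          rw [intervalIntegral.integral_add hi1 hi2, intervalIntegral.integral_const, smul_eq_mul,
            intervalIntegral.integral_const_mul, integral_one_div_sq hα1 h12]
          ring
      _ = Q' / α₁ - Q' / α₂ + c * (α₂ - α₁) := by ring
  -- last range
  have hthird : ∫ α in α₂..1, I α ≤ Q / α₂ - Q := by
    have hmaj : ContinuousOn (fun α : ℝ => Q * (1 / α ^ 2)) (Set.uIcc α₂ 1) := (hci2 hα2 h2).const_smul Q
    calc ∫ α in α₂..1, I α ≤ ∫ α in α₂..1, Q * (1 / α ^ 2) :=
          intervalIntegral.integral_mono_on h2 hIc hmaj.intervalIntegrable fun α hα => by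
            have := hb3 α hα; simp only [mul_one_div]; linarith
      _ = Q * (1 / α₂ - 1 / 1) := by
          rw [intervalIntegral.integral_const_mul, integral_one_div_sq hα2 h2]
      _ = Q / α₂ - Q := by ring
  have hE' : 0 ≤ E / α₁ := by positivity
  have hQ'' : 0 ≤ Q' / α₂ := by positivity
  have hcc : c * (α₁ - α₀) + c * (α₂ - α₁) ≤ c := by nlinarith
  rw [← intervalIntegral.integral_of_le (h02.trans h2),
    ← intervalIntegral.integral_add_adjacent_intervals hIa (hIb.trans hIc),
    ← intervalIntegral.integral_add_adjacent_intervals hIb hIc]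
  linarith

namespace Restricted.Sharp

open Literature.NumberTheory.Sieve (pretentiousDistSq minPretentiousDistSq)

variable {g : ℕ → ℂ}

/-! ### The damped distance summand `p^{-1-α} - Re(g(p) p^{-1-α-iy}) = p^{-α}(1 - Re(g(p) conj p^{iy}))/p` -/

/-- The damped summand in distance form:
`p^{-(1+α)} - Re(g(p)p^{-(1+α+iy)}) = p^{-α} (1 - Re(g(p) conj p^{iy}))/p` (`p ≥ 1`). [folklore] -/
theorem dampedTerm_eq {p : ℕ} (hp : 0 < p) (α y : ℝ) :
    (p : ℝ) ^ (-(1 + α)) - (g p * (p : ℂ) ^ (-((1 : ℂ) + α + y * I))).re =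
      (p : ℝ) ^ (-α) * (1 - (g p * conj ((p : ℂ) ^ ((y : ℂ) * I))).re) / p := by
  have hp0 : (0 : ℝ) < p := by exact_mod_cast hp
  rw [re_mul_cpow_neg_add (g p) hp α y]
  have hpow : (p : ℝ) ^ (-(1 + α)) = (p : ℝ) ^ (-α) / p := by
    rw [show (-(1 + α)) = -α + (-1 : ℝ) by ring, Real.rpow_add hp0, Real.rpow_neg_one]
    ring
  rw [hpow]
  ring

/-- At `α = 0` the damped summand is the distance summand `(1 - Re(g(p) conj p^{iy}))/p` (`p ≥ 1`). [folklore] -/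
theorem dampedTerm_zero_eq {p : ℕ} (hp : 0 < p) (y : ℝ) :
    (p : ℝ) ^ (-(1 + (0 : ℝ))) - (g p * (p : ℂ) ^ (-((1 : ℂ) + (0 : ℝ) + y * I))).re =
      (1 - (g p * conj ((p : ℂ) ^ ((y : ℂ) * I))).re) / p := by
  rw [dampedTerm_eq hp 0 y, neg_zero, Real.rpow_zero, one_mul]

/-- The damped summand is nonnegative (`|g| ≤ 1`, `p ≥ 1`). [folklore] -/
theorem dampedTerm_nonneg (hgb : ∀ n, ‖g n‖ ≤ 1) {p : ℕ} (hp : 0 < p) (α y : ℝ) :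
    0 ≤ (p : ℝ) ^ (-(1 + α)) - (g p * (p : ℂ) ^ (-((1 : ℂ) + α + y * I))).re := by
  have h := re_mul_cpow_le hgb hp ((1 : ℂ) + α + y * I)
  have hre : ((1 : ℂ) + α + y * I).re = 1 + α := by simp
  rw [hre] at h
  linarith

/-- The damped summand is at most `e` times the damped summand at a smaller damping... precisely: for
`0 ≤ α`, `α log p ≤ 1`: `(1 - Re(g(p) conj p^{iy}))/p ≤ 3 (p^{-(1+α)} - Re(g(p)p^{-(1+α+iy)}))`
(`p^{-α} ≥ e^{-1} ≥ 1/3`). [folklore] -/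
theorem distTerm_le_three_mul_dampedTerm (hgb : ∀ n, ‖g n‖ ≤ 1) {p : ℕ} (hp : 0 < p) {α : ℝ}
    (hαp : α * Real.log p ≤ 1) (y : ℝ) :
    (1 - (g p * conj ((p : ℂ) ^ ((y : ℂ) * I))).re) / p ≤
      3 * ((p : ℝ) ^ (-(1 + α)) - (g p * (p : ℂ) ^ (-((1 : ℂ) + α + y * I))).re) := by
  have hp0 : (0 : ℝ) < p := by exact_mod_cast hp
  rw [dampedTerm_eq hp α y]
  have ht : 0 ≤ (1 - (g p * conj ((p : ℂ) ^ ((y : ℂ) * I))).re) / p := term_nonneg hgb p y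
  -- `p^{-α} = exp(-α log p) ≥ exp(-1) ≥ 1/3`
  have hpow : (1 : ℝ) / 3 ≤ (p : ℝ) ^ (-α) := by
    rw [Real.rpow_def_of_pos hp0]
    have h1 : Real.exp (-1) ≤ Real.exp (Real.log p * -α) := Real.exp_le_exp.2 (by nlinarith)
    have h2 : (1 : ℝ) / 3 ≤ Real.exp (-1) := by
      rw [Real.exp_neg, one_div]
      exact inv_anti₀ (Real.exp_pos 1) (by have := Real.exp_one_lt_d9; linarith)
    exact h2.trans h1
  calc (1 - (g p * conj ((p : ℂ) ^ ((y : ℂ) * I))).re) / p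
      = 3 * ((1 / 3) * ((1 - (g p * conj ((p : ℂ) ^ ((y : ℂ) * I))).re) / p)) := by ring
    _ ≤ 3 * ((p : ℝ) ^ (-α) * ((1 - (g p * conj ((p : ℂ) ^ ((y : ℂ) * I))).re) / p)) := by
        gcongr
    _ = 3 * ((p : ℝ) ^ (-α) * (1 - (g p * conj ((p : ℂ) ^ ((y : ℂ) * I))).re) / p) := by ring

/-! ### The restricted series on `Re s = 1 + α` in terms of the damped off-block and block distances -/

variable {ι : Type*} {𝓙 : Finset ι} {blk : ι → Finset ℕ}

/-- **The restricted series on `Re s = 1 + α`, damped form**: for a block system at level `N = ⌊x⌋`, `x ≥ 3`,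
`0 < α ≤ 1`, with `O` = the primes `≤ N` outside the blocks and `E` = the union of the blocks,
`‖𝒢_a(1+α+iy)‖ ≤ (e^{12}/α) exp(-D_O(α,y) - D_E(α,y)/2)`, where
`D_P(α,y) = ∑_{p ∈ P} (p^{-(1+α)} - Re(g(p)p^{-(1+α+iy)}))` is the damped distance carried by `P`
(`LSeries_restr_eq`, `norm_blockEuler_le`, the cosh trick `norm_prod_blockEuler_sub_one_le`, and
`∑_{p ≤ N} p^{-1-α} ≤ log(1/α) + 9`). [cite: GranvilleSoundararajan2003, Lemma 2] -/
theorem norm_LSeries_restr_le_exp_damped [DecidableEq ι] {x : ℝ} (h : IsBlockSystem 𝓙 blk ⌊x⌋₊)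
    (hg : ∀ m n, g (m * n) = g m * g n) (hg1 : g 1 = 1) (hgb : ∀ n, ‖g n‖ ≤ 1)
    {α : ℝ} (hα : 0 < α) (hα1 : α ≤ 1) (y : ℝ) :
    ‖LSeries (restr 𝓙 blk g ⌊x⌋₊) (1 + α + y * I)‖ ≤
      Real.exp 12 / α *
        Real.exp (-(∑ p ∈ Nat.primesBelow (⌊x⌋₊ + 1) \ 𝓙.biUnion blk,
              ((p : ℝ) ^ (-(1 + α)) - (g p * (p : ℂ) ^ (-((1 : ℂ) + α + y * I))).re)) -
            (∑ p ∈ 𝓙.biUnion blk, ((p : ℝ) ^ (-(1 + α)) - (g p * (p : ℂ) ^ (-((1 : ℂ) + α + y * I))).re)) / 2) := by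
  set N : ℕ := ⌊x⌋₊ with hN
  set s : ℂ := (1 : ℂ) + α + y * I with hs
  have hsre : s.re = 1 + α := by simp [hs]
  have hs1 : (1 : ℝ) ≤ s.re := by rw [hsre]; linarith
  have h1 := norm_LSeries_restr_le h hg hg1 hgb hs1
  set E := 𝓙.biUnion blk with hE
  set O := Nat.primesBelow (N + 1) \ E with hO
  set Pr := Nat.primesLE N with hPr
  have hPB : Nat.primesBelow (N + 1) = Pr := rfl
  have hEsub : E ⊆ Pr := hPB ▸ h.biUnion_subset (t := 𝓙) le_rfl
  set dt : ℕ → ℝ := fun p => (p : ℝ) ^ (-(1 + α)) - (g p * (p : ℂ) ^ (-s)).re with hdt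
  -- rewrite the exponent
  have hout : ∑ p ∈ O, (g p * (p : ℂ) ^ (-s)).re = ∑ p ∈ O, (p : ℝ) ^ (-(1 + α)) - ∑ p ∈ O, dt p := by
    rw [← Finset.sum_sub_distrib]
    refine Finset.sum_congr rfl fun p _ => ?_
    simp only [hdt]; ring
  have hblk : ∑ i ∈ 𝓙, (∑ p ∈ blk i, (p : ℝ) ^ (-s.re) + (∑ p ∈ blk i, g p * (p : ℂ) ^ (-s)).re) / 2 =
      ∑ p ∈ E, (p : ℝ) ^ (-(1 + α)) - (∑ p ∈ E, dt p) / 2 := by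
    rw [hE, Finset.sum_biUnion (fun i hi j hj hij => h.disjoint i hi j hj hij),
      Finset.sum_biUnion (fun i hi j hj hij => h.disjoint i hi j hj hij), Finset.sum_div, ← Finset.sum_sub_distrib]
    refine Finset.sum_congr rfl fun i _ => ?_
    rw [hsre, Complex.re_sum, ← Finset.sum_add_distrib, Finset.sum_div, Finset.sum_div, ← Finset.sum_sub_distrib]
    refine Finset.sum_congr rfl fun p _ => ?_
    simp only [hdt]; ring
  have hsumO : ∑ p ∈ O, (p : ℝ) ^ (-(1 + α)) + ∑ p ∈ E, (p : ℝ) ^ (-(1 + α)) = ∑ p ∈ Pr, (p : ℝ) ^ (-(1 + α)) := by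
    rw [hO, hPB, Finset.sum_sdiff hEsub]
  have hPr_le : ∑ p ∈ Pr, (p : ℝ) ^ (-(1 + α)) ≤ Real.log (1 / α) + 9 := sum_primesLE_rpow_le hα hα1 N
  have hexp_eq : 3 + ∑ p ∈ O, (g p * (p : ℂ) ^ (-s)).re +
      ∑ i ∈ 𝓙, (∑ p ∈ blk i, (p : ℝ) ^ (-s.re) + (∑ p ∈ blk i, g p * (p : ℂ) ^ (-s)).re) / 2 =
      3 + ∑ p ∈ Pr, (p : ℝ) ^ (-(1 + α)) - (∑ p ∈ O, dt p) - (∑ p ∈ E, dt p) / 2 := by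
    rw [hout, hblk, ← hsumO]; ring
  rw [hexp_eq] at h1
  refine h1.trans ?_
  have hfin : Real.exp (3 + ∑ p ∈ Pr, (p : ℝ) ^ (-(1 + α)) - (∑ p ∈ O, dt p) - (∑ p ∈ E, dt p) / 2) ≤
      Real.exp (12 + Real.log (1 / α) + (-(∑ p ∈ O, dt p) - (∑ p ∈ E, dt p) / 2)) :=
    Real.exp_le_exp.2 (by linarith)
  refine hfin.trans (le_of_eq ?_)
  rw [Real.exp_add, Real.exp_add, Real.exp_log (by positivity)]
  simp only [hdt, hs, hO, hE, hN]
  ring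

/-- **Tail domination**: if the block primes are `≤ Q ≤ w`, `z = exp(1/α_m) ≤ x` and `0 ≤ α ≤ α_m`, then the
distance of `g` from `n^{iy}` carried by the primes of `(w, z]` is at most `3 D_O(α,y)`
(those primes are off-block, `≤ ⌊x⌋`, and `p^{-α} ≥ e^{-1}` for `p ≤ z`). [folklore] -/
theorem twistDist_tail_le_three_mul_outSum [DecidableEq ι] (𝓙 : Finset ι) (blk : ι → Finset ℕ) {x : ℝ}
    (hgb : ∀ n, ‖g n‖ ≤ 1) {Q w z αm α : ℝ} (hblkQ : ∀ i ∈ 𝓙, ∀ p ∈ blk i, (p : ℝ) ≤ Q) (hQw : Q ≤ w)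
    (hwz : w ≤ z) (hz : z = Real.exp (1 / αm)) (hzx : z ≤ x) (hαm : 0 < αm) (hααm : α ≤ αm)
    (y : ℝ) :
    pretentiousDistSq g (fun n : ℕ => (n : ℂ) ^ ((y : ℂ) * I)) z -
        pretentiousDistSq g (fun n : ℕ => (n : ℂ) ^ ((y : ℂ) * I)) w ≤
      3 * ∑ p ∈ Nat.primesBelow (⌊x⌋₊ + 1) \ 𝓙.biUnion blk,
        ((p : ℝ) ^ (-(1 + α)) - (g p * (p : ℂ) ^ (-((1 : ℂ) + α + y * I))).re) := by
  rw [Sharp.pretentiousDistSq_sub_eq_sum_sdiff _ _ hwz, Finset.mul_sum]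
  have hsub : Nat.primesLE ⌊z⌋₊ \ Nat.primesLE ⌊w⌋₊ ⊆ Nat.primesBelow (⌊x⌋₊ + 1) \ 𝓙.biUnion blk := by
    intro p hp
    rw [Finset.mem_sdiff, Nat.mem_primesLE, Nat.mem_primesLE] at hp
    have hpN : p ≤ ⌊x⌋₊ := hp.1.1.trans (Nat.floor_le_floor hzx)
    rw [Finset.mem_sdiff, show Nat.primesBelow (⌊x⌋₊ + 1) = Nat.primesLE ⌊x⌋₊ from rfl, Nat.mem_primesLE]
    refine ⟨⟨hpN, hp.1.2⟩, fun hpE => hp.2 ⟨?_, hp.1.2⟩⟩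
    rw [Finset.mem_biUnion] at hpE
    obtain ⟨i, hi, hpi⟩ := hpE
    exact Nat.le_floor ((hblkQ i hi p hpi).trans hQw)
  refine (Finset.sum_le_sum fun p hp => ?_).trans
    (Finset.sum_le_sum_of_subset_of_nonneg hsub fun p hp _ => ?_)
  · rw [Finset.mem_sdiff, Nat.mem_primesLE, Nat.mem_primesLE] at hp
    have hpp : p.Prime := hp.1.2
    have hpz : (p : ℝ) ≤ z := by
      have h1 : (p : ℝ) ≤ ⌊z⌋₊ := by exact_mod_cast hp.1.1
      exact h1.trans (Nat.floor_le (by rw [hz]; exact (Real.exp_pos _).le))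
    refine distTerm_le_three_mul_dampedTerm hgb hpp.pos ?_ y
    -- `α log p ≤ α_m · (1/α_m) = 1`
    have hlogp : Real.log p ≤ 1 / αm := by
      have := Real.log_le_log (by exact_mod_cast hpp.pos) hpz
      rwa [hz, Real.log_exp] at this
    have hlogp0 : 0 ≤ Real.log p := Real.log_nonneg (by exact_mod_cast hpp.one_lt.le)
    calc α * Real.log p ≤ αm * (1 / αm) := mul_le_mul hααm hlogp hlogp0 hαm.le
      _ = 1 := by field_simp
  · rw [Finset.mem_sdiff, show Nat.primesBelow (⌊x⌋₊ + 1) = Nat.primesLE ⌊x⌋₊ from rfl, Nat.mem_primesLE] at hp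
    have := dampedTerm_nonneg hgb hp.1.2.pos α y
    linarith

/-- **The full distance at `α = 0` splits into its off-block and block parts**: for a block system at level
`⌊x⌋`, `𝔻(g, n^{iy}; x)² = D_O(0,y) + D_E(0,y)`. [folklore] -/
theorem pretentiousDistSq_eq_outSum_add_blkSum [DecidableEq ι] {x : ℝ} (h : IsBlockSystem 𝓙 blk ⌊x⌋₊) (y : ℝ) :
    pretentiousDistSq g (fun n : ℕ => (n : ℂ) ^ ((y : ℂ) * I)) x =
      ∑ p ∈ Nat.primesBelow (⌊x⌋₊ + 1) \ 𝓙.biUnion blk,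
          ((p : ℝ) ^ (-(1 + (0 : ℝ))) - (g p * (p : ℂ) ^ (-((1 : ℂ) + (0 : ℝ) + y * I))).re) +
        ∑ p ∈ 𝓙.biUnion blk, ((p : ℝ) ^ (-(1 + (0 : ℝ))) - (g p * (p : ℂ) ^ (-((1 : ℂ) + (0 : ℝ) + y * I))).re) := by
  set Pr := Nat.primesLE ⌊x⌋₊ with hPr
  have hPB : Nat.primesBelow (⌊x⌋₊ + 1) = Pr := rfl
  have hEsub : 𝓙.biUnion blk ⊆ Pr := hPB ▸ h.biUnion_subset (t := 𝓙) le_rfl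
  unfold pretentiousDistSq
  rw [hPB, ← hPr, Finset.sum_sdiff hEsub]
  refine Finset.sum_congr rfl fun p hp => ?_
  rw [hPr, Nat.mem_primesLE] at hp
  exact (dampedTerm_zero_eq hp.2.pos y).symm

/-- The block part in the form of `HalaszRestrictedSharpTwists` (freezing):
`D_E(α,y) = ∑_{p ∈ E} p^{-α}(1 - Re(g(p) conj p^{iy}))/p`. [folklore] -/
theorem blkSum_eq_damped [DecidableEq ι] {N : ℕ} (h : IsBlockSystem 𝓙 blk N) (α y : ℝ) :
    ∑ p ∈ 𝓙.biUnion blk, ((p : ℝ) ^ (-(1 + α)) - (g p * (p : ℂ) ^ (-((1 : ℂ) + α + y * I))).re) =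
      ∑ p ∈ 𝓙.biUnion blk, (p : ℝ) ^ (-α) * (1 - (g p * conj ((p : ℂ) ^ ((y : ℂ) * I))).re) / p := by
  refine Finset.sum_congr rfl fun p hp => ?_
  rw [Finset.mem_biUnion] at hp
  obtain ⟨i, hi, hpi⟩ := hp
  exact dampedTerm_eq (h.prime_of_mem hi hpi).pos α y

/-- The damped sums are nonnegative. [folklore] -/
theorem dampedSum_nonneg (hgb : ∀ n, ‖g n‖ ≤ 1) {P : Finset ℕ} (hP : ∀ p ∈ P, 0 < p) (α y : ℝ) :
    0 ≤ ∑ p ∈ P, ((p : ℝ) ^ (-(1 + α)) - (g p * (p : ℂ) ^ (-((1 : ℂ) + α + y * I))).re) :=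
  Finset.sum_nonneg fun p hp => dampedTerm_nonneg hgb (hP p hp) α y

/-- The blocks' exponent in damped form: with `s = 1 + α + iy`,
`∑_i (K_i(σ) + Re z_i)/2 = ∑_{p ∈ E} p^{-(1+α)} - D_E(α,y)/2`. [folklore] -/
theorem blocks_exponent_eq [DecidableEq ι] {N : ℕ} (h : IsBlockSystem 𝓙 blk N) (α y : ℝ) :
    ∑ i ∈ 𝓙, (∑ p ∈ blk i, (p : ℝ) ^ (-((1 : ℂ) + α + y * I).re) +
        (∑ p ∈ blk i, g p * (p : ℂ) ^ (-((1 : ℂ) + α + y * I))).re) / 2 =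
      ∑ p ∈ 𝓙.biUnion blk, (p : ℝ) ^ (-(1 + α)) -
        (∑ p ∈ 𝓙.biUnion blk, ((p : ℝ) ^ (-(1 + α)) - (g p * (p : ℂ) ^ (-((1 : ℂ) + α + y * I))).re)) / 2 := by
  have hsre : ((1 : ℂ) + α + y * I).re = 1 + α := by simp
  rw [Finset.sum_biUnion (fun i hi j hj hij => h.disjoint i hi j hj hij),
    Finset.sum_biUnion (fun i hi j hj hij => h.disjoint i hi j hj hij), Finset.sum_div, ← Finset.sum_sub_distrib]
  refine Finset.sum_congr rfl fun i _ => ?_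
  rw [hsre, Complex.re_sum, ← Finset.sum_add_distrib, Finset.sum_div, Finset.sum_div, ← Finset.sum_sub_distrib]
  refine Finset.sum_congr rfl fun p _ => ?_
  ring

/-- **The block factors, damped form**: `‖∏_i (G_i(1+α+iy) - 1)‖ ≤ exp(∑_{p ∈ E} 1/p + 2 - D_E(α,y)/2)`
(`0 ≤ α`; the cosh trick `norm_prod_blockEuler_sub_one_le` and `p^{-(1+α)} ≤ 1/p`). [folklore] -/
theorem norm_prod_blockEuler_sub_one_le_damped [DecidableEq ι] {N : ℕ} (h : IsBlockSystem 𝓙 blk N)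
    (hgb : ∀ n, ‖g n‖ ≤ 1) {α : ℝ} (hα : 0 ≤ α) (y : ℝ) :
    ‖∏ i ∈ 𝓙, (blockEuler g (blk i) ((1 : ℂ) + α + y * I) - 1)‖ ≤
      Real.exp (∑ p ∈ 𝓙.biUnion blk, (1 : ℝ) / p + 2 -
        (∑ p ∈ 𝓙.biUnion blk, ((p : ℝ) ^ (-(1 + α)) - (g p * (p : ℂ) ^ (-((1 : ℂ) + α + y * I))).re)) / 2) := by
  have hs1 : (1 : ℝ) ≤ ((1 : ℂ) + α + y * I).re := by simp; linarith
  refine (norm_prod_blockEuler_sub_one_le h hgb hs1).trans (Real.exp_le_exp.2 ?_)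
  rw [blocks_exponent_eq h α y]
  have hK : ∑ p ∈ 𝓙.biUnion blk, (p : ℝ) ^ (-(1 + α)) ≤ ∑ p ∈ 𝓙.biUnion blk, (1 : ℝ) / p := by
    refine Finset.sum_le_sum fun p hp => ?_
    rw [Finset.mem_biUnion] at hp
    obtain ⟨i, hi, hpi⟩ := hp
    have hp1 : (1 : ℝ) ≤ p := by exact_mod_cast (h.prime_of_mem hi hpi).one_lt.le
    calc (p : ℝ) ^ (-(1 + α)) ≤ (p : ℝ) ^ (-1 : ℝ) :=
          Real.rpow_le_rpow_of_exponent_le hp1 (by linarith)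
      _ = 1 / p := by rw [Real.rpow_neg_one, one_div]
  linarith

/-- **The off-block Euler product on the `1`-line, damped form**:
`‖G_O(1+iu)‖ ≤ exp(∑_{p ∈ O} 1/p + 1 - D_O(0,u))`, `O` = the primes `≤ N` outside the blocks. [folklore] -/
theorem norm_blockEuler_out_line_le [DecidableEq ι] (𝓙 : Finset ι) (blk : ι → Finset ℕ) (N : ℕ)
    (hgb : ∀ n, ‖g n‖ ≤ 1) (u : ℝ) :
    ‖blockEuler g (Nat.primesBelow (N + 1) \ 𝓙.biUnion blk) ((1 : ℂ) + u * I)‖ ≤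
      Real.exp (∑ p ∈ Nat.primesBelow (N + 1) \ 𝓙.biUnion blk, (1 : ℝ) / p + 1 -
        ∑ p ∈ Nat.primesBelow (N + 1) \ 𝓙.biUnion blk,
          ((p : ℝ) ^ (-(1 + (0 : ℝ))) - (g p * (p : ℂ) ^ (-((1 : ℂ) + (0 : ℝ) + u * I))).re)) := by
  have hs1 : (1 : ℝ) ≤ ((1 : ℂ) + u * I).re := by simp
  refine (norm_blockEuler_le (N := N) hgb Finset.sdiff_subset hs1).trans (Real.exp_le_exp.2 (le_of_eq ?_))
  have hcast : ((1 : ℂ) + ((0 : ℝ) : ℂ) + u * I) = (1 : ℂ) + u * I := by push_cast; ring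
  rw [hcast]
  have hterm : ∀ p ∈ Nat.primesBelow (N + 1) \ 𝓙.biUnion blk, (p : ℝ) ^ (-(1 + (0 : ℝ))) = 1 / p := by
    intro p hp
    rw [Finset.mem_sdiff, show Nat.primesBelow (N + 1) = Nat.primesLE N from rfl, Nat.mem_primesLE] at hp
    have hp0 : (0 : ℝ) < p := by exact_mod_cast hp.1.2.pos
    rw [add_zero, Real.rpow_neg hp0.le, Real.rpow_one, one_div]
  have hsplit : ∑ p ∈ Nat.primesBelow (N + 1) \ 𝓙.biUnion blk,
      ((p : ℝ) ^ (-(1 + (0 : ℝ))) - (g p * (p : ℂ) ^ (-((1 : ℂ) + u * I))).re) =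
      ∑ p ∈ Nat.primesBelow (N + 1) \ 𝓙.biUnion blk, (1 : ℝ) / p -
        ∑ p ∈ Nat.primesBelow (N + 1) \ 𝓙.biUnion blk, (g p * (p : ℂ) ^ (-((1 : ℂ) + u * I))).re := by
    rw [← Finset.sum_sub_distrib]
    exact Finset.sum_congr rfl fun p hp => by rw [hterm p hp]
  rw [hsplit]
  ring

/-- **Poisson transport for the off-block Euler product**: if `‖G_O(1+iu)‖ ≤ B` for `|u| ≤ T` then
`‖G_O(1+α+iy)‖ ≤ B + (4α/T) e⁵ log x` for `α > 0`, `|y| ≤ T/2` (`x ≥ 3`, level `N = ⌊x⌋`; `G_O` is the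
`L`-series of the completely multiplicative `g 1_{(n,E)=1}` cut to `⌊x⌋`-friable integers, `LSeries_sieveOut_eq`,
and `PoissonSmoothing.norm_LSeries_le_of_bound`). [cite: GranvilleSoundararajan2003, Lemma 2.2] -/
theorem norm_blockEuler_out_shift_le [DecidableEq ι] {x : ℝ} (h : IsBlockSystem 𝓙 blk ⌊x⌋₊)
    (hg : ∀ m n, g (m * n) = g m * g n) (hg1 : g 1 = 1) (hgb : ∀ n, ‖g n‖ ≤ 1) (hx : 3 ≤ x)
    {T B : ℝ} (hT : 0 < T)
    (hB : ∀ u : ℝ, |u| ≤ T → ‖blockEuler g (Nat.primesBelow (⌊x⌋₊ + 1) \ 𝓙.biUnion blk) ((1 : ℂ) + u * I)‖ ≤ B)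
    {α y : ℝ} (hα : 0 < α) (hy : |y| ≤ T / 2) :
    ‖blockEuler g (Nat.primesBelow (⌊x⌋₊ + 1) \ 𝓙.biUnion blk) ((1 : ℂ) + α + y * I)‖ ≤
      B + 4 * α / T * (Real.exp 5 * Real.log x) := by
  set E := 𝓙.biUnion blk with hE
  have hEp : ∀ p ∈ E, p.Prime := fun p hp => by
    rw [hE, Finset.mem_biUnion] at hp
    obtain ⟨i, hi, hpi⟩ := hp
    exact h.prime_of_mem hi hpi
  set a := smoothCut (sieveOut E g) ⌊x⌋₊ with ha
  have hab : ∀ n, ‖sieveOut E g n‖ ≤ 1 := norm_sieveOut_le hgb E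
  obtain ⟨hsum, hS⟩ := tsum_norm_term_one_le (g := sieveOut E g) hab hx
  have hLa : ∀ s : ℂ, 0 < s.re → LSeries a s = blockEuler g (Nat.primesBelow (⌊x⌋₊ + 1) \ E) s :=
    fun s hs => (LSeries_sieveOut_eq (N := ⌊x⌋₊) hg hg1 hgb hEp hs).2
  have hT2 : 0 < T / 2 := by linarith
  have hP := PoissonSmoothing.norm_LSeries_le_of_bound (α := α) hα (a := a) (σ₀ := 1)
    (by simpa using hsum) hT2 y (B := B) (fun u hu => by
      have huT : |u| ≤ T := by linarith [abs_nonneg y]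
      rw [Complex.ofReal_one, hLa ((1 : ℂ) + u * I) (by simp)]
      exact hB u huT)
  have hre : (0 : ℝ) < (((1 : ℝ) : ℂ) + α + y * I).re := by simp; linarith
  rw [hLa _ hre] at hP
  push_cast at hP
  refine hP.trans ?_
  have hS' : ∑' n : ℕ, ‖a n‖ / (n : ℝ) ^ (1 : ℝ) ≤ Real.exp 5 * Real.log x := hS
  have e1 : 2 * α / (T / 2) = 4 * α / T := by field_simp; ring
  rw [e1]
  have h0 : (0 : ℝ) ≤ 4 * α / T := by positivity
  have := mul_le_mul_of_nonneg_left hS' h0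
  simpa using this

/-! ### The sharp per-`α` bound -/

/-- `min(c·u, c·v) = c · min(u, v)` for `c ≥ 0`. [folklore] -/
theorem min_mul_left_of_nonneg {c u v : ℝ} (hc : 0 ≤ c) : min (c * u) (c * v) = c * min u v := by
  rcases le_total u v with huv | huv
  · rw [min_eq_left huv, min_eq_left (mul_le_mul_of_nonneg_left huv hc)]
  · rw [min_eq_right huv, min_eq_right (mul_le_mul_of_nonneg_left huv hc)]

/-- From `log u < v` and `0 ≤ u` conclude `u ≤ exp v`. [folklore] -/
theorem le_exp_of_log_lt {u v : ℝ} (hu : 0 ≤ u) (h : Real.log u < v) : u ≤ Real.exp v := by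
  rcases hu.eq_or_lt with rfl | hu0
  · exact (Real.exp_pos v).le
  · rw [← Real.exp_log hu0]; exact Real.exp_le_exp.2 h.le

set_option maxHeartbeats 1600000 in
/-- **The sharp per-`α` bound for the restricted series** (the heart of the series).  Setting: a block system at
level `N = ⌊x⌋` (`x ≥ 3`) with block primes `≤ Q ≤ w = exp((log 2x)^θ) - 1`, `g` completely multiplicative with
`|g| ≤ 1`, `4 ≤ T ≤ x`, `M = M(x, T) = min_{|t| ≤ T} 𝔻(g, n^{it}; x)²`, a scale `α_m ∈ (0, 1]` with
`exp((log 2x)^θ) ≤ z := exp(1/α_m) ≤ x`, the clustering inequality of `HalaszRestrictedSharpTwists`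
(`twist_cluster_of_vk` at `X = 2x`, constant `C`), `∑_{p ∈ E} log p/p ≤ L`, and the two regime conditions
`9M + 60 + C ≤ log(1/α_m) - θ log log 2x` (far twists are useless) and `(2 + e^{9M+60+C}) α_m L ≤ 1` (block
freezing).  Then there is `d ≥ 0` (the frozen block configuration; `d = 0` if no dangerous twist exists) with

  `‖𝒢_a(1+α+iy)‖ ≤ e^{12} e^{-M/2}/α + e^{13} e^{-d/2} min(log x · e^{-(M-d)}, 1/α) + e^{K₀+8} (4α/T) log x`

for all `0 < α ≤ α_m`, `|y| ≤ T/2`, `K₀ = ∑_{p ∈ E} 1/p`.  Non-dangerous points (off-block damped distance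
`≥ M/2`) give the first term (`norm_LSeries_restr_le_exp_damped`); dangerous points cluster within
`e^{6M+C} α_m` of a reference one and see its block configuration `d` up to `1`, every twist `|u| ≤ T` has
off-block distance `≥ M - d - 1` (clustering again + freezing + `M ≤ 𝔻²`), so Poisson smoothing of the
off-block Euler product alone gives `e^{8.5} log x · e^{-(M-d)} e^{-d/2}`, and the direct bound gives
`e^{12.5} e^{-d/2}/α`. [cite: GranvilleSoundararajan2003, §4] -/
theorem norm_LSeries_restr_sharp [DecidableEq ι] {x : ℝ} (h : IsBlockSystem 𝓙 blk ⌊x⌋₊)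
    (hg : ∀ m n, g (m * n) = g m * g n) (hg1 : g 1 = 1) (hgb : ∀ n, ‖g n‖ ≤ 1) (hx : 3 ≤ x)
    {T : ℝ} (hT : 4 ≤ T) (hTx : T ≤ x)
    {Q θ : ℝ} (hblkQ : ∀ i ∈ 𝓙, ∀ p ∈ blk i, (p : ℝ) ≤ Q)
    (hQw : Q ≤ Real.exp (Real.log (2 * x) ^ θ) - 1)
    {C : ℝ}
    (hcl : ∀ t t₁ z : ℝ, |t - t₁| ≤ 2 * x → Real.exp (Real.log (2 * x) ^ θ) ≤ z → z ≤ 2 * x →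
      min (Real.log (|t - t₁| * Real.log z)) (Real.log (Real.log z) - θ * Real.log (Real.log (2 * x))) ≤
        2 * ((pretentiousDistSq g (fun n : ℕ => (n : ℂ) ^ ((t : ℂ) * I)) z -
              pretentiousDistSq g (fun n : ℕ => (n : ℂ) ^ ((t : ℂ) * I)) (Real.exp (Real.log (2 * x) ^ θ) - 1)) +
            (pretentiousDistSq g (fun n : ℕ => (n : ℂ) ^ ((t₁ : ℂ) * I)) z -
              pretentiousDistSq g (fun n : ℕ => (n : ℂ) ^ ((t₁ : ℂ) * I)) (Real.exp (Real.log (2 * x) ^ θ) - 1))) + C)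
    {αm : ℝ} (hαm0 : 0 < αm) (hαm1 : αm ≤ 1) (hzx : Real.exp (1 / αm) ≤ x)
    (hwz : Real.exp (Real.log (2 * x) ^ θ) ≤ Real.exp (1 / αm))
    {L : ℝ} (hL : ∑ p ∈ 𝓙.biUnion blk, Real.log p / p ≤ L)
    (hreg : 9 * minPretentiousDistSq g x T + 60 + C ≤ Real.log (1 / αm) - θ * Real.log (Real.log (2 * x)))
    (hfr : (2 * αm + Real.exp (9 * minPretentiousDistSq g x T + 60 + C) * αm) * L ≤ 1) :
    ∃ d : ℝ, 0 ≤ d ∧ ∀ α : ℝ, 0 < α → α ≤ αm → ∀ y : ℝ, |y| ≤ T / 2 →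
      ‖LSeries (restr 𝓙 blk g ⌊x⌋₊) (1 + α + y * I)‖ ≤
        Real.exp 12 * Real.exp (-(minPretentiousDistSq g x T) / 2) / α +
        Real.exp 13 * Real.exp (-d / 2) *
          min (Real.log x * Real.exp (-(minPretentiousDistSq g x T - d))) (1 / α) +
        Real.exp (∑ p ∈ 𝓙.biUnion blk, (1 : ℝ) / p + 8) * (4 * α / T) * Real.log x := by
  set N : ℕ := ⌊x⌋₊ with hN
  set E := 𝓙.biUnion blk with hE
  set O := Nat.primesBelow (N + 1) \ E with hO
  set M : ℝ := minPretentiousDistSq g x T with hM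
  set w : ℝ := Real.exp (Real.log (2 * x) ^ θ) - 1 with hw
  set z : ℝ := Real.exp (1 / αm) with hz
  set K₀ : ℝ := ∑ p ∈ E, (1 : ℝ) / p with hK₀
  set ℓN : ℝ := Real.log x with hℓN
  -- the damped sums
  set dt : ℝ → ℝ → ℕ → ℝ := fun α y p =>
    (p : ℝ) ^ (-(1 + α)) - (g p * (p : ℂ) ^ (-((1 : ℂ) + α + y * I))).re with hdt
  set OutS : ℝ → ℝ → ℝ := fun α y => ∑ p ∈ O, dt α y p with hOutS
  set BlkS : ℝ → ℝ → ℝ := fun α y => ∑ p ∈ E, dt α y p with hBlkS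
  set tw : ℝ → ℕ → ℂ := fun t n => (n : ℂ) ^ ((t : ℂ) * I) with htw
  -- basic facts
  have hx0 : 0 < x := by linarith
  have hT0 : 0 < T := by linarith
  have hM0 : 0 ≤ M := Sieve.minPretentiousDistSq_nonneg hgb x (by linarith)
  have hEp : ∀ p ∈ E, p.Prime := fun p hp => by
    rw [hE, Finset.mem_biUnion] at hp
    obtain ⟨i, hi, hpi⟩ := hp
    exact h.prime_of_mem hi hpi
  have hOp : ∀ p ∈ O, p.Prime := fun p hp => by
    rw [hO, Finset.mem_sdiff, show Nat.primesBelow (N + 1) = Nat.primesLE N from rfl, Nat.mem_primesLE] at hp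
    exact hp.1.2
  have hOutS0 : ∀ α y, 0 ≤ OutS α y := fun α y =>
    dampedSum_nonneg hgb (fun p hp => (hOp p hp).pos) α y
  have hBlkS0 : ∀ α y, 0 ≤ BlkS α y := fun α y =>
    dampedSum_nonneg hgb (fun p hp => (hEp p hp).pos) α y
  have hℓN1 : 1 < ℓN := by
    rw [hℓN, ← Real.log_exp 1]
    exact Real.log_lt_log (Real.exp_pos 1) (by have := Real.exp_one_lt_d9; linarith)
  have hℓN0 : 0 < ℓN := by linarith
  -- `w, z`
  have hw0 : 0 ≤ w := by
    rw [hw, sub_nonneg, ← Real.exp_zero]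
    exact Real.exp_le_exp.2 (Real.rpow_nonneg (Real.log_nonneg (by linarith)) θ)
  have hQw' : Q ≤ w := hQw
  have hwz' : w ≤ z := by rw [hw, hz]; linarith [hwz]
  have hlogz : Real.log z = 1 / αm := by rw [hz, Real.log_exp]
  have hz2x : z ≤ 2 * x := hzx.trans (by linarith)
  -- the direct bound
  have hdirect : ∀ {α : ℝ}, 0 < α → α ≤ 1 → ∀ y : ℝ,
      ‖LSeries (restr 𝓙 blk g N) (1 + α + y * I)‖ ≤ Real.exp 12 / α * Real.exp (-(OutS α y) - (BlkS α y) / 2) := by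
    intro α hα hα1 y
    have := norm_LSeries_restr_le_exp_damped h hg hg1 hgb hα hα1 y
    simpa only [hOutS, hBlkS, hdt, hO, hE, hN] using this
  -- tail domination and the clustering consequences
  have htail : ∀ {α : ℝ}, α ≤ αm → ∀ y : ℝ,
      pretentiousDistSq g (tw y) z - pretentiousDistSq g (tw y) w ≤ 3 * OutS α y := by
    intro α hααm y
    have := twistDist_tail_le_three_mul_outSum 𝓙 blk hgb hblkQ hQw' hwz' hz hzx hαm0 hααm y
    simpa only [hOutS, hdt, hO, hE, hN, htw] using this
  have hsecond : 9 * M + 60 + C ≤ Real.log (Real.log z) - θ * Real.log (Real.log (2 * x)) := by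
    rw [hlogz]; exact hreg
  -- (K1)/(K2): two twists with small off-block distances are close
  have hclose : ∀ {α α' : ℝ} {y y' : ℝ} {A : ℝ}, 0 ≤ α → α ≤ αm → 0 ≤ α' → α' ≤ αm →
      |y - y'| ≤ 2 * x → 3 * OutS α y + 3 * OutS α' y' < A → 2 * A + C ≤ 9 * M + 60 + C →
      |y - y'| ≤ Real.exp (2 * A + C) * αm := by
    intro α α' y y' A hα hααm hα' hα'αm hyy hA hAreg
    have hmin := hcl y y' z hyy (by rw [hz]; exact hwz) hz2x
    have ht1 := htail hααm y
    have ht2 := htail hα'αm y'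
    have hlt : min (Real.log (|y - y'| * Real.log z)) (Real.log (Real.log z) - θ * Real.log (Real.log (2 * x))) <
        2 * A + C := by
      have : 2 * ((pretentiousDistSq g (tw y) z - pretentiousDistSq g (tw y) w) +
          (pretentiousDistSq g (tw y') z - pretentiousDistSq g (tw y') w)) + C < 2 * A + C := by linarith
      exact lt_of_le_of_lt (by simpa only [htw, hw] using hmin) this
    have hfirst : Real.log (|y - y'| * Real.log z) < 2 * A + C := by
      rcases lt_or_ge (Real.log (|y - y'| * Real.log z)) (Real.log (Real.log z) - θ * Real.log (Real.log (2 * x)))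
        with hlt' | hle'
      · rwa [min_eq_left hlt'.le] at hlt
      · rw [min_eq_right hle'] at hlt; linarith
    rw [hlogz] at hfirst
    have hpos : 0 ≤ |y - y'| * (1 / αm) := by positivity
    have := le_exp_of_log_lt hpos hfirst
    rw [mul_one_div, div_le_iff₀ hαm0] at this
    exact this
  -- the dangerous case split
  by_cases hD : ∃ α y : ℝ, 0 < α ∧ α ≤ αm ∧ |y| ≤ T / 2 ∧ OutS α y < M / 2
  swap
  · -- no dangerous point: `d = 0`
    refine ⟨0, le_rfl, fun α hα hααm y hy => ?_⟩
    have hnd : M / 2 ≤ OutS α y := by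
      by_contra hlt; exact hD ⟨α, y, hα, hααm, hy, lt_of_not_ge hlt⟩
    have h1 := hdirect hα (hααm.trans hαm1) y
    have h2 : Real.exp 12 / α * Real.exp (-(OutS α y) - (BlkS α y) / 2) ≤ Real.exp 12 * Real.exp (-M / 2) / α := by
      rw [div_mul_eq_mul_div]
      gcongr
      have := hBlkS0 α y
      linarith
    have h3 : 0 ≤ Real.exp 13 * Real.exp (-(0 : ℝ) / 2) * min (ℓN * Real.exp (-(M - 0))) (1 / α) := by
      have : 0 ≤ min (ℓN * Real.exp (-(M - 0))) (1 / α) := le_min (by positivity) (by positivity)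
      positivity
    have h4 : 0 ≤ Real.exp (K₀ + 8) * (4 * α / T) * ℓN := by positivity
    linarith
  -- a dangerous reference point `(α*, y*)`, frozen block configuration `d`
  obtain ⟨αs, ys, hαs0, hαsm, hys, hDs⟩ := hD
  set d : ℝ := BlkS αs ys with hd
  have hd0 : 0 ≤ d := hBlkS0 αs ys
  have hysT : |ys| ≤ T := by linarith [abs_nonneg ys]
  -- freezing
  have hE1 : ∀ p ∈ E, 1 ≤ p := fun p hp => (hEp p hp).one_lt.le
  have hfreeze : ∀ {α y : ℝ}, 0 ≤ α → α ≤ αm → |y - ys| ≤ Real.exp (9 * M + 60 + C) * αm →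
      |BlkS α y - d| ≤ 1 := by
    intro α y hα hααm hyys
    have h1 := Sharp.abs_sum_dampedDist_sub_le hgb hE1 hα hαs0.le y ys
    rw [← blkSum_eq_damped h α y, ← blkSum_eq_damped h αs ys] at h1
    have h2 : (2 * |α - αs| + |y - ys|) * ∑ p ∈ E, Real.log p / p ≤ 1 := by
      have hαα : |α - αs| ≤ αm := by
        rw [abs_le]; constructor <;> linarith
      have hsum0 : 0 ≤ ∑ p ∈ E, Real.log p / p := Finset.sum_nonneg fun p hp =>
        div_nonneg (Real.log_nonneg (by exact_mod_cast hE1 p hp)) (Nat.cast_nonneg p)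
      have hL0 : 0 ≤ L := hsum0.trans hL
      calc (2 * |α - αs| + |y - ys|) * ∑ p ∈ E, Real.log p / p
          ≤ (2 * αm + Real.exp (9 * M + 60 + C) * αm) * L :=
            mul_le_mul (by linarith) hL hsum0 (by positivity)
        _ ≤ 1 := hfr
    have : |BlkS α y - BlkS αs ys| ≤ 1 := by
      simpa only [hBlkS, hdt, hE] using h1.trans h2
    simpa only [hd] using this
  -- (K4): every twist `|u| ≤ T` has off-block distance `≥ M - d - 1`
  have hMout : ∀ u : ℝ, |u| ≤ T → M - d - 1 ≤ OutS 0 u := by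
    intro u hu
    by_cases hu10 : OutS 0 u < M + 10
    swap
    · have := not_lt.mp hu10; linarith
    -- close to `ys` by clustering
    have huys : |u - ys| ≤ 2 * x := by
      calc |u - ys| ≤ |u| + |ys| := abs_sub _ _
        _ ≤ T + T / 2 := add_le_add hu hys
        _ ≤ 2 * x := by linarith
    have hcl1 := hclose (α := 0) (α' := αs) (y := u) (y' := ys) (A := 3 * (M + 10) + 3 * (M / 2))
      le_rfl hαm0.le hαs0.le hαsm huys (by linarith) (by linarith)
    have hexp_eq : 2 * (3 * (M + 10) + 3 * (M / 2)) + C = 9 * M + 60 + C := by ring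
    rw [hexp_eq] at hcl1
    have hfz := hfreeze (α := 0) (y := u) le_rfl hαm0.le hcl1
    have hBle : BlkS 0 u ≤ d + 1 := by linarith [(abs_le.1 hfz).2]
    -- `M ≤ 𝔻²(u) = OutS 0 u + BlkS 0 u`
    have hMle : M ≤ pretentiousDistSq g (tw u) x := minPretentiousDistSq_le_of_abs_le hgb x hu
    have hsplit : pretentiousDistSq g (tw u) x = OutS 0 u + BlkS 0 u := by
      have := pretentiousDistSq_eq_outSum_add_blkSum (g := g) h u
      simpa only [hOutS, hBlkS, hdt, hO, hE, hN, htw] using this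
    linarith
  -- (K5): the off-block Euler product on the line
  have hline : ∀ u : ℝ, |u| ≤ T →
      ‖blockEuler g O ((1 : ℂ) + u * I)‖ ≤ Real.exp 6 * ℓN * Real.exp (-K₀) * Real.exp (-(M - d)) := by
    intro u hu
    have h1 := norm_blockEuler_out_line_le (g := g) 𝓙 blk N hgb u
    have h1' : ‖blockEuler g O ((1 : ℂ) + u * I)‖ ≤ Real.exp (∑ p ∈ O, (1 : ℝ) / p + 1 - OutS 0 u) := by
      simpa only [hOutS, hdt, hO, hE, hN] using h1
    refine h1'.trans ?_
    have hsumO : ∑ p ∈ O, (1 : ℝ) / p = ∑ p ∈ Nat.primesLE N, (1 : ℝ) / p - K₀ := by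
      have hEsub : E ⊆ Nat.primesLE N := h.biUnion_subset (t := 𝓙) le_rfl
      rw [hK₀, hO, show Nat.primesBelow (N + 1) = Nat.primesLE N from rfl, ← Finset.sum_sdiff hEsub]
      ring
    have hMert : ∑ p ∈ Nat.primesLE N, (1 : ℝ) / p ≤ Real.log ℓN + 4 := sum_primesLE_inv_le hx
    have hMo := hMout u hu
    calc Real.exp (∑ p ∈ O, (1 : ℝ) / p + 1 - OutS 0 u)
        ≤ Real.exp (Real.log ℓN + 6 - K₀ - (M - d)) := Real.exp_le_exp.2 (by rw [hsumO]; linarith)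
      _ = Real.exp 6 * ℓN * Real.exp (-K₀) * Real.exp (-(M - d)) := by
          rw [show Real.log ℓN + 6 - K₀ - (M - d) = 6 + Real.log ℓN + -K₀ + -(M - d) by ring,
            Real.exp_add, Real.exp_add, Real.exp_add, Real.exp_log hℓN0]
  -- the bound, by cases on dangerousness
  refine ⟨d, hd0, fun α hα hααm y hy => ?_⟩
  have hα1 : α ≤ 1 := hααm.trans hαm1
  have hyT : |y| ≤ T := by linarith [abs_nonneg y]
  set RHS : ℝ := Real.exp 12 * Real.exp (-M / 2) / α +
      Real.exp 13 * Real.exp (-d / 2) * min (ℓN * Real.exp (-(M - d))) (1 / α) +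
      Real.exp (K₀ + 8) * (4 * α / T) * ℓN with hRHS
  have hmin0 : 0 ≤ min (ℓN * Real.exp (-(M - d))) (1 / α) := le_min (by positivity) (by positivity)
  have hterm1 : 0 ≤ Real.exp 12 * Real.exp (-M / 2) / α := by positivity
  have hterm2 : 0 ≤ Real.exp 13 * Real.exp (-d / 2) * min (ℓN * Real.exp (-(M - d))) (1 / α) := by positivity
  have hterm3 : 0 ≤ Real.exp (K₀ + 8) * (4 * α / T) * ℓN := by positivity
  by_cases hdang : OutS α y < M / 2
  · -- dangerous: cluster, freeze, Poisson
    have hyys : |y - ys| ≤ Real.exp (9 * M + 60 + C) * αm := by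
      have hyy2 : |y - ys| ≤ 2 * x := by
        calc |y - ys| ≤ |y| + |ys| := abs_sub _ _
          _ ≤ T / 2 + T / 2 := add_le_add hy hys
          _ ≤ 2 * x := by linarith
      have h1 := hclose (α := α) (α' := αs) (y := y) (y' := ys) (A := 3 * (M / 2) + 3 * (M / 2))
        hα.le hααm hαs0.le hαsm hyy2 (by linarith) (by linarith)
      refine h1.trans (mul_le_mul_of_nonneg_right (Real.exp_le_exp.2 (by linarith)) hαm0.le)
    have hfz := hfreeze hα.le hααm hyys
    have hBge : d - 1 ≤ BlkS α y := by linarith [(abs_le.1 hfz).1]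
    -- Poisson on the off-block product
    have hshift := norm_blockEuler_out_shift_le h hg hg1 hgb hx hT0 hline hα hy
    -- the block factors
    have hblk := norm_prod_blockEuler_sub_one_le_damped (g := g) h hgb hα.le y
    have hblk' : ‖∏ i ∈ 𝓙, (blockEuler g (blk i) ((1 : ℂ) + α + y * I) - 1)‖ ≤
        Real.exp (K₀ + 2.5) * Real.exp (-d / 2) := by
      refine hblk.trans ?_
      rw [← Real.exp_add]
      refine Real.exp_le_exp.2 ?_
      have : ∑ p ∈ 𝓙.biUnion blk, ((p : ℝ) ^ (-(1 + α)) - (g p * (p : ℂ) ^ (-((1 : ℂ) + α + y * I))).re) =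
          BlkS α y := by simp only [hBlkS, hdt, hE]
      rw [this, ← hE, ← hK₀]
      linarith
    -- the factorisation
    have hfac : LSeries (restr 𝓙 blk g N) ((1 : ℂ) + α + y * I) =
        blockEuler g O ((1 : ℂ) + α + y * I) * ∏ i ∈ 𝓙, (blockEuler g (blk i) ((1 : ℂ) + α + y * I) - 1) := by
      have := (LSeries_restr_eq h hg hg1 hgb (s := (1 : ℂ) + α + y * I) (by simp; linarith)).2
      simpa only [hO, hE, hN] using this
    have hA1 : ‖LSeries (restr 𝓙 blk g N) (1 + α + y * I)‖ ≤
        Real.exp 8.5 * ℓN * Real.exp (-(M - d)) * Real.exp (-d / 2) + Real.exp (K₀ + 7.5) * (4 * α / T) * ℓN := by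
      rw [hfac, norm_mul]
      have hG0 : 0 ≤ Real.exp 6 * ℓN * Real.exp (-K₀) * Real.exp (-(M - d)) + 4 * α / T * (Real.exp 5 * ℓN) := by
        positivity
      calc ‖blockEuler g O ((1 : ℂ) + α + y * I)‖ * ‖∏ i ∈ 𝓙, (blockEuler g (blk i) ((1 : ℂ) + α + y * I) - 1)‖
          ≤ (Real.exp 6 * ℓN * Real.exp (-K₀) * Real.exp (-(M - d)) + 4 * α / T * (Real.exp 5 * ℓN)) *
              (Real.exp (K₀ + 2.5) * Real.exp (-d / 2)) :=
            mul_le_mul hshift hblk' (norm_nonneg _) hG0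
        _ = Real.exp 8.5 * ℓN * Real.exp (-(M - d)) * Real.exp (-d / 2) +
              Real.exp (K₀ + 7.5) * (4 * α / T) * ℓN * Real.exp (-d / 2) := by
            have e1 : Real.exp 6 * Real.exp (-K₀) * Real.exp (K₀ + 2.5) = Real.exp 8.5 := by
              rw [← Real.exp_add, ← Real.exp_add]; norm_num
            have e2 : Real.exp 5 * Real.exp (K₀ + 2.5) = Real.exp (K₀ + 7.5) := by
              rw [← Real.exp_add]; ring_nf
            calc (Real.exp 6 * ℓN * Real.exp (-K₀) * Real.exp (-(M - d)) + 4 * α / T * (Real.exp 5 * ℓN)) *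
                  (Real.exp (K₀ + 2.5) * Real.exp (-d / 2))
                = (Real.exp 6 * Real.exp (-K₀) * Real.exp (K₀ + 2.5)) * ℓN * Real.exp (-(M - d)) * Real.exp (-d / 2) +
                    (Real.exp 5 * Real.exp (K₀ + 2.5)) * (4 * α / T) * ℓN * Real.exp (-d / 2) := by ring
              _ = _ := by rw [e1, e2]
        _ ≤ Real.exp 8.5 * ℓN * Real.exp (-(M - d)) * Real.exp (-d / 2) + Real.exp (K₀ + 7.5) * (4 * α / T) * ℓN := by
            have hed : Real.exp (-d / 2) ≤ 1 := by
              rw [← Real.exp_zero]; exact Real.exp_le_exp.2 (by linarith)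
            have h0 : 0 ≤ Real.exp (K₀ + 7.5) * (4 * α / T) * ℓN := by positivity
            have := mul_le_mul_of_nonneg_left hed h0
            linarith
    have hA2 : ‖LSeries (restr 𝓙 blk g N) (1 + α + y * I)‖ ≤ Real.exp 12.5 * Real.exp (-d / 2) / α := by
      refine (hdirect hα hα1 y).trans ?_
      rw [div_mul_eq_mul_div]
      refine div_le_div_of_nonneg_right ?_ hα.le
      rw [show Real.exp 12.5 = Real.exp 12 * Real.exp 0.5 by rw [← Real.exp_add]; norm_num, mul_assoc]
      refine mul_le_mul_of_nonneg_left ?_ (Real.exp_pos _).le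
      rw [← Real.exp_add]
      refine Real.exp_le_exp.2 ?_
      have := hOutS0 α y
      linarith
    -- combine: `‖𝒜‖ ≤ min(A₁, A₂) + tail ≤ e^{13} e^{-d/2} min(ℓN e^{-(M-d)}, 1/α) + tail`
    have hcomb : ‖LSeries (restr 𝓙 blk g N) (1 + α + y * I)‖ ≤
        Real.exp 13 * Real.exp (-d / 2) * min (ℓN * Real.exp (-(M - d))) (1 / α) +
          Real.exp (K₀ + 7.5) * (4 * α / T) * ℓN := by
      have htail0 : 0 ≤ Real.exp (K₀ + 7.5) * (4 * α / T) * ℓN := by positivity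
      have hle13a : Real.exp 8.5 ≤ Real.exp 13 := Real.exp_le_exp.2 (by norm_num)
      have hle13b : Real.exp 12.5 ≤ Real.exp 13 := Real.exp_le_exp.2 (by norm_num)
      rcases le_total (ℓN * Real.exp (-(M - d))) (1 / α) with hcase | hcase
      · rw [min_eq_left hcase]
        calc ‖LSeries (restr 𝓙 blk g N) (1 + α + y * I)‖
            ≤ Real.exp 8.5 * ℓN * Real.exp (-(M - d)) * Real.exp (-d / 2) + Real.exp (K₀ + 7.5) * (4 * α / T) * ℓN := hA1
          _ ≤ Real.exp 13 * Real.exp (-d / 2) * (ℓN * Real.exp (-(M - d))) + Real.exp (K₀ + 7.5) * (4 * α / T) * ℓN := by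
              have h0 : 0 ≤ ℓN * Real.exp (-(M - d)) * Real.exp (-d / 2) := by positivity
              have := mul_le_mul_of_nonneg_right hle13a h0
              linarith
      · rw [min_eq_right hcase]
        calc ‖LSeries (restr 𝓙 blk g N) (1 + α + y * I)‖ ≤ Real.exp 12.5 * Real.exp (-d / 2) / α := hA2
          _ ≤ Real.exp 13 * Real.exp (-d / 2) * (1 / α) := by
              rw [div_eq_mul_one_div]
              have h0 : 0 ≤ Real.exp (-d / 2) * (1 / α) := by positivity
              have := mul_le_mul_of_nonneg_right hle13b h0
              linarith
          _ ≤ Real.exp 13 * Real.exp (-d / 2) * (1 / α) + Real.exp (K₀ + 7.5) * (4 * α / T) * ℓN := by linarith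
    have htail_le : Real.exp (K₀ + 7.5) * (4 * α / T) * ℓN ≤ Real.exp (K₀ + 8) * (4 * α / T) * ℓN := by
      gcongr; norm_num
    have : ‖LSeries (restr 𝓙 blk g N) (1 + α + y * I)‖ ≤ RHS := by rw [hRHS]; linarith
    simpa only [hRHS, hM, hℓN, hK₀, hE] using this
  · -- non-dangerous
    have hnd : M / 2 ≤ OutS α y := le_of_not_gt hdang
    have h1 := hdirect hα hα1 y
    have h2 : Real.exp 12 / α * Real.exp (-(OutS α y) - (BlkS α y) / 2) ≤ Real.exp 12 * Real.exp (-M / 2) / α := by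
      rw [div_mul_eq_mul_div]
      gcongr
      have := hBlkS0 α y
      linarith
    have : ‖LSeries (restr 𝓙 blk g N) (1 + α + y * I)‖ ≤ RHS := by rw [hRHS]; linarith
    simpa only [hRHS, hM, hℓN, hK₀, hE] using this

/-! ### Small real inequalities for the final bookkeeping -/

/-- `(v + 1) e^{-v/2} ≤ 2` for all real `v`. [folklore] -/
theorem add_one_mul_exp_neg_half_le_two (v : ℝ) : (v + 1) * Real.exp (-v / 2) ≤ 2 := by
  have h1 : v / 2 + 1 ≤ Real.exp (v / 2) := Real.add_one_le_exp (v / 2)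
  have h2 : 0 < Real.exp (-v / 2) := Real.exp_pos _
  have h3 : Real.exp (v / 2) * Real.exp (-v / 2) = 1 := by
    rw [← Real.exp_add, show v / 2 + -v / 2 = 0 by ring, Real.exp_zero]
  nlinarith

/-- `log ℓ + 2 ≤ 2 √ℓ` for `ℓ ≥ 1`. [folklore] -/
theorem log_add_two_le_two_sqrt {ℓ : ℝ} (hℓ : 1 ≤ ℓ) : Real.log ℓ + 2 ≤ 2 * Real.sqrt ℓ := by
  have hs : 0 < Real.sqrt ℓ := Real.sqrt_pos.mpr (by linarith)
  have h1 : Real.log (Real.sqrt ℓ) ≤ Real.sqrt ℓ - 1 := Real.log_le_sub_one_of_pos hs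
  have h2 : Real.log ℓ = 2 * Real.log (Real.sqrt ℓ) := by
    conv_lhs => rw [← Real.sq_sqrt (by linarith : (0:ℝ) ≤ ℓ)]
    rw [Real.log_pow]; norm_num
  linarith

/-- `e^a + 1 ≤ e^{a+1}` for `a ≥ 0`. [folklore] -/
theorem exp_add_one_le_exp_add_one {a : ℝ} (ha : 0 ≤ a) : Real.exp a + 1 ≤ Real.exp (a + 1) := by
  rw [Real.exp_add]
  have h1 : 1 ≤ Real.exp a := by rw [← Real.exp_zero]; exact Real.exp_le_exp.2 ha
  have h2 : (2 : ℝ) ≤ Real.exp 1 := by have := Real.add_one_le_exp (1:ℝ); linarith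
  nlinarith [Real.exp_pos a]

end Restricted.Sharp

end Halasz

end Literature.NumberTheory.LFunctions
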